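import Summits.Ventures.LatticeQCDFlow.Scoring.OnePlaquetteSU3
import Mathlib.Data.Nat.Choose.Sum
import HarnessLib

/-!
# Exact rational moments of the SU(3) one-plaquette density: `∫∫ |Δ|² (1 + Re tr U)^k = (2π)² · su3Moment k`

HONEST FRAMING: exact (Metropolis-corrected) sampling algorithms for lattice gauge theory;
figures of merit are autocorrelation/cost numbers at stated couplings and volumes; no
continuum-physics claim.

Venture `LatticeQCDFlow` (cell pub-lqcd), sub-topic `Scoring`; FANOUT row 5 (`s0-sun-a`, S0-C
implementation A — the 'exact 2-d plaquette oracle' column).  NEW WORK of the cell (placement rule);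
continues `Scoring/OnePlaquetteSU3.lean`.

The key identity `1 + Re tr U = ½ (1 + e^{iθ₁})(1 + e^{iθ₂})(1 + e^{−i(θ₁+θ₂)})` (`= ½ det(1 + U)` on
the maximal torus; `one_add_reTrSU3_eq`) makes every moment of the SU(3) one-plaquette density a
ONE-dimensional binomial sum — no double Fourier series, no Bessel functions:

* `integral2_torusMode_mul_pow` — `∫_0^{2π}∫_0^{2π} e^{i(aθ₁+bθ₂)} (1 + Re tr U)^k = (2π)² 2^{−k} T_k(a,b)`
  with `T_k(a,b) = Σ_{s=0}^{k} C(k,s) C(k,s−a) C(k,s−b)` (`tripleBinom`; three binomial expansions and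
  Fourier orthogonality `integral2_torusMode`);
* `weylSU3_eq_sum` — the 19 Fourier monomials of `|Δ|² = Σ_v c_v e^{i(a_v θ₁ + b_v θ₂)}` (integer
  `c_v`, constant term `6 = 3!`; tables `su3wA`, `su3wB`, `su3wC`);
* `integral2_weylSU3_mul_pow` — `∫∫ |Δ|² (1 + Re tr U)^k = (2π)² · su3Moment k` with the exact rational
  `su3Moment k = 2^{−k} Σ_v c_v T_k(a_v,b_v)` (`6, 6, 9, 33/2, 69/2, 633/8, …`; `su3Moment k / 6` are the
  Haar moments of `1 + Re tr U` on `SU(3)`), `integral2_weylSU3` (`k = 0`: `6 (2π)²`), and the numerator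
  moments `integral2_plaqSU3_weylSU3_mul_pow`:
  `∫∫ (Re tr U / 3) |Δ|² (1 + Re tr U)^k = (2π)² (su3Moment (k+1) − su3Moment k)/3`.
-/

namespace Summit.Ventures.LatticeQCDFlow.Scoring

open MeasureTheory intervalIntegral Finset
open scoped Real Nat

/-! ### 4. The binomial identity for the moments of `1 + Re tr U` against a Fourier mode -/

/-- **`1 + Re tr U = ½ (1 + e^{iθ₁})(1 + e^{iθ₂})(1 + e^{−i(θ₁+θ₂)})`** (`= ½ det(1 + U)` for
`U = diag(e^{iθ₁}, e^{iθ₂}, e^{−iθ₁−iθ₂})`). -/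
theorem one_add_reTrSU3_eq (θ₁ θ₂ : ℝ) :
    (1 : ℂ) + (reTrSU3 θ₁ θ₂ : ℂ)
      = (1 / 2 : ℂ) * ((torusMode 1 0 θ₁ θ₂ + 1) * ((torusMode 0 1 θ₁ θ₂ + 1)
          * (torusMode (-1) (-1) θ₁ θ₂ + 1))) := by
  have hu : Complex.exp ((θ₁ : ℂ) * Complex.I) ≠ 0 := Complex.exp_ne_zero _
  have hw : Complex.exp ((θ₂ : ℂ) * Complex.I) ≠ 0 := Complex.exp_ne_zero _
  have e12 : Complex.exp (((θ₁ : ℂ) + (θ₂ : ℂ)) * Complex.I)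
      = Complex.exp ((θ₁ : ℂ) * Complex.I) * Complex.exp ((θ₂ : ℂ) * Complex.I) := by
    rw [add_mul, Complex.exp_add]
  simp only [reTrSU3, Complex.ofReal_add, ofReal_cos_eq, e12, torusMode_eq_zpow, zpow_one, zpow_zero,
    zpow_neg, mul_one, one_mul]
  field_simp
  ring

/-- Zero-extended binomial coefficient: `C(k, j)` for `j ∈ ℤ`, zero when `j < 0` (and when `j > k`). -/
def zchoose (k : ℕ) (j : ℤ) : ℕ := if j < 0 then 0 else k.choose j.toNat

/-- `T_k(a, b) = Σ_{s=0}^{k} C(k,s) C(k,s−a) C(k,s−b)` — the constant Fourier coefficient of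
`e^{i(aθ₁+bθ₂)} (1+e^{iθ₁})^k (1+e^{iθ₂})^k (1+e^{−i(θ₁+θ₂)})^k`. -/
def tripleBinom (k : ℕ) (a b : ℤ) : ℕ :=
  ∑ s ∈ range (k + 1), k.choose s * zchoose k (s - a) * zchoose k (s - b)

/-- Collapsing an indicator sum onto the zero-extended binomial coefficient. -/
theorem sum_ite_choose_eq_zchoose (k s : ℕ) (a : ℤ) :
    (∑ p ∈ range (k + 1), if a + (p : ℤ) = s then (k.choose p : ℂ) else 0) = (zchoose k (s - a) : ℂ) := by
  by_cases h : (s : ℤ) - a < 0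
  · rw [Finset.sum_eq_zero]
    · simp [zchoose, h]
    · intro p _
      rw [if_neg]
      omega
  · obtain ⟨t, ht⟩ := Int.eq_ofNat_of_zero_le (not_lt.mp h)
    have hz : zchoose k (s - a) = k.choose t := by
      simp [zchoose, ht]
    rw [hz]
    have hcond : ∀ p : ℕ, (a + (p : ℤ) = s) ↔ p = t := fun p => by omega
    simp_rw [hcond]
    rw [Finset.sum_ite_eq']
    split_ifs with hm
    · rfl
    · rw [Finset.mem_range, not_lt] at hm
      rw [Nat.choose_eq_zero_of_lt (by omega)]
      simp

/-- Bringing the innermost of three summations outside. -/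
theorem sum_comm3 {α β γ M : Type*} [AddCommMonoid M] (s : Finset α) (t : Finset β) (u : Finset γ)
    (f : α → β → γ → M) :
    (∑ x ∈ s, ∑ y ∈ t, ∑ z ∈ u, f x y z) = ∑ z ∈ u, ∑ x ∈ s, ∑ y ∈ t, f x y z := by
  rw [Finset.sum_congr rfl (fun x _ => Finset.sum_comm (s := t) (t := u) (f := f x))]
  exact Finset.sum_comm

/-- Pointwise: `e^{i(aθ₁+bθ₂)} (1 + Re tr U)^k` as a triple binomial sum of Fourier modes. -/
theorem torusMode_mul_pow_eq_sum (a b : ℤ) (k : ℕ) (θ₁ θ₂ : ℝ) :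
    torusMode a b θ₁ θ₂ * ((1 : ℂ) + (reTrSU3 θ₁ θ₂ : ℂ)) ^ k
      = (1 / 2 : ℂ) ^ k * ∑ p ∈ range (k + 1), ∑ q ∈ range (k + 1), ∑ s ∈ range (k + 1),
          ((k.choose p : ℂ) * (k.choose q : ℂ) * (k.choose s : ℂ))
            * torusMode (a + p - s) (b + q - s) θ₁ θ₂ := by
  have hA : (torusMode 1 0 θ₁ θ₂ + 1) ^ k
      = ∑ p ∈ range (k + 1), (k.choose p : ℂ) * torusMode (p * 1) (p * 0) θ₁ θ₂ := by
    rw [add_pow]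
    refine Finset.sum_congr rfl fun p _ => ?_
    rw [one_pow, mul_one, torusMode_pow, mul_comm]
  have hB : (torusMode 0 1 θ₁ θ₂ + 1) ^ k
      = ∑ q ∈ range (k + 1), (k.choose q : ℂ) * torusMode (q * 0) (q * 1) θ₁ θ₂ := by
    rw [add_pow]
    refine Finset.sum_congr rfl fun q _ => ?_
    rw [one_pow, mul_one, torusMode_pow, mul_comm]
  have hC : (torusMode (-1) (-1) θ₁ θ₂ + 1) ^ k
      = ∑ s ∈ range (k + 1), (k.choose s : ℂ) * torusMode (s * (-1)) (s * (-1)) θ₁ θ₂ := by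
    rw [add_pow]
    refine Finset.sum_congr rfl fun s _ => ?_
    rw [one_pow, mul_one, torusMode_pow, mul_comm]
  rw [one_add_reTrSU3_eq, mul_pow, mul_pow, mul_pow, hA, hB, hC]
  simp_rw [Finset.sum_mul_sum, Finset.mul_sum]
  refine Finset.sum_congr rfl fun p _ => Finset.sum_congr rfl fun q _ =>
    Finset.sum_congr rfl fun s _ => ?_
  have key : torusMode a b θ₁ θ₂ * torusMode (p * 1) (p * 0) θ₁ θ₂ * torusMode (q * 0) (q * 1) θ₁ θ₂
      * torusMode (s * (-1)) (s * (-1)) θ₁ θ₂ = torusMode (a + p - s) (b + q - s) θ₁ θ₂ := by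
    rw [torusMode_mul, torusMode_mul, torusMode_mul]
    congr 1 <;> ring
  rw [← key]
  ring

/-- **Moments of `1 + Re tr U` against a Fourier mode**:
`∫_0^{2π}∫_0^{2π} e^{i(aθ₁+bθ₂)} (1 + Re tr U)^k dθ₂ dθ₁ = (2π)² 2^{−k} T_k(a, b)`. -/
theorem integral2_torusMode_mul_pow (a b : ℤ) (k : ℕ) :
    (∫ θ₁ in (0 : ℝ)..2 * π, ∫ θ₂ in (0 : ℝ)..2 * π,
        torusMode a b θ₁ θ₂ * ((1 : ℂ) + (reTrSU3 θ₁ θ₂ : ℂ)) ^ k)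
      = (2 * (π : ℂ)) ^ 2 * (1 / 2 : ℂ) ^ k * (tripleBinom k a b : ℂ) := by
  simp_rw [torusMode_mul_pow_eq_sum a b k]
  rw [integral2_const_mul, integral2_finset_sum _ (fun p _ => by fun_prop)]
  have h1 : ∀ p ∈ range (k + 1),
      (∫ θ₁ in (0 : ℝ)..2 * π, ∫ θ₂ in (0 : ℝ)..2 * π, ∑ q ∈ range (k + 1), ∑ s ∈ range (k + 1),
          ((k.choose p : ℂ) * (k.choose q : ℂ) * (k.choose s : ℂ)) * torusMode (a + p - s) (b + q - s) θ₁ θ₂)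
        = ∑ q ∈ range (k + 1), ∑ s ∈ range (k + 1),
            ((k.choose p : ℂ) * (k.choose q : ℂ) * (k.choose s : ℂ))
              * (if a + (p : ℤ) - s = 0 ∧ b + (q : ℤ) - s = 0 then (2 * (π : ℂ)) ^ 2 else 0) := by
    intro p _
    rw [integral2_finset_sum _ (fun q _ => by fun_prop)]
    refine Finset.sum_congr rfl fun q _ => ?_
    rw [integral2_finset_sum _ (fun s _ => by fun_prop)]
    refine Finset.sum_congr rfl fun s _ => ?_
    rw [integral2_const_mul, integral2_torusMode]
  rw [Finset.sum_congr rfl h1]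
  -- collapse the indicator sums: bring `s` outside
  rw [sum_comm3]
  have hinner : ∀ s ∈ range (k + 1),
      (∑ p ∈ range (k + 1), ∑ q ∈ range (k + 1),
        ((k.choose p : ℂ) * (k.choose q : ℂ) * (k.choose s : ℂ))
          * (if a + (p : ℤ) - s = 0 ∧ b + (q : ℤ) - s = 0 then (2 * (π : ℂ)) ^ 2 else 0))
        = (k.choose s : ℂ) * (2 * (π : ℂ)) ^ 2
          * ((∑ p ∈ range (k + 1), if a + (p : ℤ) = s then (k.choose p : ℂ) else 0)
            * (∑ q ∈ range (k + 1), if b + (q : ℤ) = s then (k.choose q : ℂ) else 0)) := by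
    intro s _
    rw [Finset.sum_mul_sum, Finset.mul_sum]
    refine Finset.sum_congr rfl fun p _ => ?_
    rw [Finset.mul_sum]
    refine Finset.sum_congr rfl fun q _ => ?_
    simp only [sub_eq_zero]
    by_cases hp : a + (p : ℤ) = s
    · by_cases hq : b + (q : ℤ) = s
      · simp only [hp, hq, and_self, if_true]; ring
      · simp only [hp, hq, and_false, if_false, if_true]; ring
    · simp only [hp, false_and, if_false]; ring
  rw [Finset.sum_congr rfl hinner]
  simp_rw [sum_ite_choose_eq_zchoose]
  unfold tripleBinom
  push_cast
  simp only [Finset.mul_sum]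
  refine Finset.sum_congr rfl fun s _ => ?_
  ring

/-! ### 5. The 19 Fourier monomials of `|Δ|²` and the rational moments -/

/-- First exponents `a_v` of the Fourier monomials of `|Δ|² = Σ_v c_v e^{i(a_v θ₁ + b_v θ₂)}` (19 terms,
indexed by `0 … 18`; zero elsewhere). -/
def su3wA : ℕ → ℤ
  | 0 => -4 | 1 => -3 | 2 => -3 | 3 => -2 | 4 => -2 | 5 => -2 | 6 => -1 | 7 => -1 | 8 => 0 | 9 => 0
  | 10 => 0 | 11 => 1 | 12 => 1 | 13 => 2 | 14 => 2 | 15 => 2 | 16 => 3 | 17 => 3 | 18 => 4 | _ => 0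

/-- Second exponents `b_v` of the Fourier monomials of `|Δ|²`. -/
def su3wB : ℕ → ℤ
  | 0 => -2 | 1 => -3 | 2 => 0 | 3 => -4 | 4 => -1 | 5 => 2 | 6 => -2 | 7 => 1 | 8 => -3 | 9 => 0
  | 10 => 3 | 11 => -1 | 12 => 2 | 13 => -2 | 14 => 1 | 15 => 4 | 16 => 0 | 17 => 3 | 18 => 2 | _ => 0

/-- Integer coefficients `c_v` of the Fourier monomials of `|Δ|²` (constant term `c = 6 = 3!`). -/
def su3wC : ℕ → ℤ
  | 0 => -1 | 1 => 2 | 2 => 2 | 3 => -1 | 4 => -2 | 5 => -1 | 6 => -2 | 7 => -2 | 8 => 2 | 9 => 6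
  | 10 => 2 | 11 => -2 | 12 => -2 | 13 => -1 | 14 => -2 | 15 => -1 | 16 => 2 | 17 => 2 | 18 => -1 | _ => 0

/-- **Fourier expansion of the Weyl density**: `|Δ|² = Σ_{v<19} c_v e^{i(a_v θ₁ + b_v θ₂)}`. -/
theorem weylSU3_eq_sum (θ₁ θ₂ : ℝ) :
    (weylSU3 θ₁ θ₂ : ℂ) = ∑ i ∈ range 19, (su3wC i : ℂ) * torusMode (su3wA i) (su3wB i) θ₁ θ₂ := by
  have hu : Complex.exp ((θ₁ : ℂ) * Complex.I) ≠ 0 := Complex.exp_ne_zero _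
  have hw : Complex.exp ((θ₂ : ℂ) * Complex.I) ≠ 0 := Complex.exp_ne_zero _
  have e1 : Complex.exp (((θ₁ : ℂ) - (θ₂ : ℂ)) * Complex.I)
      = Complex.exp ((θ₁ : ℂ) * Complex.I) * (Complex.exp ((θ₂ : ℂ) * Complex.I))⁻¹ := by
    rw [sub_mul, Complex.exp_sub, div_eq_mul_inv]
  have e2 : Complex.exp ((2 * (θ₁ : ℂ) + (θ₂ : ℂ)) * Complex.I)
      = Complex.exp ((θ₁ : ℂ) * Complex.I) ^ 2 * Complex.exp ((θ₂ : ℂ) * Complex.I) := by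
    rw [show (2 * (θ₁ : ℂ) + (θ₂ : ℂ)) * Complex.I
        = (θ₁ : ℂ) * Complex.I + (θ₁ : ℂ) * Complex.I + (θ₂ : ℂ) * Complex.I by ring,
      Complex.exp_add, Complex.exp_add]
    ring
  have e3 : Complex.exp (((θ₁ : ℂ) + 2 * (θ₂ : ℂ)) * Complex.I)
      = Complex.exp ((θ₁ : ℂ) * Complex.I) * Complex.exp ((θ₂ : ℂ) * Complex.I) ^ 2 := by
    rw [show ((θ₁ : ℂ) + 2 * (θ₂ : ℂ)) * Complex.I
        = (θ₁ : ℂ) * Complex.I + ((θ₂ : ℂ) * Complex.I + (θ₂ : ℂ) * Complex.I) by ring,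
      Complex.exp_add, Complex.exp_add]
    ring
  simp only [weylSU3, Complex.ofReal_mul, Complex.ofReal_sub, Complex.ofReal_add, Complex.ofReal_ofNat,
    ofReal_cos_eq, e1, e2, e3, Finset.sum_range_succ, Finset.sum_range_zero, su3wA, su3wB, su3wC,
    torusMode_eq_zpow, zpow_neg, zpow_ofNat, Int.cast_neg, Int.cast_ofNat, Int.cast_one]
  field_simp
  ring

/-- The exact rational moments `su3Moment k = (2π)⁻² ∫∫ |Δ|² (1 + Re tr U)^k = 2^{−k} Σ_v c_v T_k(a_v,b_v)`
(`6, 6, 9, 33/2, 69/2, 633/8, …`; `su3Moment k / 6` are the Haar moments of `1 + Re tr U`). -/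
def su3Moment (k : ℕ) : ℚ :=
  (∑ i ∈ range 19, (su3wC i : ℚ) * (tripleBinom k (su3wA i) (su3wB i) : ℚ)) / 2 ^ k

/-- **The moments of the Weyl density**: `∫_0^{2π}∫_0^{2π} |Δ|² (1 + Re tr U)^k = (2π)² · su3Moment k`. -/
theorem integral2_weylSU3_mul_pow (k : ℕ) :
    (∫ θ₁ in (0 : ℝ)..2 * π, ∫ θ₂ in (0 : ℝ)..2 * π, weylSU3 θ₁ θ₂ * (1 + reTrSU3 θ₁ θ₂) ^ k)
      = (2 * π) ^ 2 * ((su3Moment k : ℚ) : ℝ) := by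
  apply Complex.ofReal_injective
  rw [← intervalIntegral.integral_ofReal]
  simp_rw [← intervalIntegral.integral_ofReal]
  push_cast
  simp_rw [weylSU3_eq_sum, Finset.sum_mul]
  rw [integral2_finset_sum _ (fun i _ => by fun_prop)]
  have hterm : ∀ i ∈ range 19,
      (∫ θ₁ in (0 : ℝ)..2 * π, ∫ θ₂ in (0 : ℝ)..2 * π,
          (su3wC i : ℂ) * torusMode (su3wA i) (su3wB i) θ₁ θ₂ * ((1 : ℂ) + (reTrSU3 θ₁ θ₂ : ℂ)) ^ k)
        = (su3wC i : ℂ) * ((2 * (π : ℂ)) ^ 2 * (1 / 2 : ℂ) ^ k * (tripleBinom k (su3wA i) (su3wB i) : ℂ)) := by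
    intro i _
    simp_rw [mul_assoc]
    rw [integral2_const_mul, integral2_torusMode_mul_pow]
    ring
  rw [Finset.sum_congr rfl hterm]
  unfold su3Moment
  push_cast
  rw [Finset.sum_div, Finset.mul_sum]
  refine Finset.sum_congr rfl fun i _ => ?_
  rw [one_div, inv_pow]
  field_simp

/-- Numerator moments: `∫∫ (Re tr U / 3) |Δ|² (1 + Re tr U)^k = (2π)² (su3Moment (k+1) − su3Moment k)/3`
(since `Re tr U / 3 = ((1 + Re tr U) − 1)/3`). -/
theorem integral2_plaqSU3_weylSU3_mul_pow (k : ℕ) :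
    (∫ θ₁ in (0 : ℝ)..2 * π, ∫ θ₂ in (0 : ℝ)..2 * π,
        plaqSU3 θ₁ θ₂ * (weylSU3 θ₁ θ₂ * (1 + reTrSU3 θ₁ θ₂) ^ k))
      = (2 * π) ^ 2 * (((su3Moment (k + 1) - su3Moment k) / 3 : ℚ) : ℝ) := by
  have hpt : ∀ θ₁ θ₂ : ℝ, plaqSU3 θ₁ θ₂ * (weylSU3 θ₁ θ₂ * (1 + reTrSU3 θ₁ θ₂) ^ k)
      = (1 / 3 : ℝ) * (weylSU3 θ₁ θ₂ * (1 + reTrSU3 θ₁ θ₂) ^ (k + 1))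
        - (1 / 3 : ℝ) * (weylSU3 θ₁ θ₂ * (1 + reTrSU3 θ₁ θ₂) ^ k) := by
    intro θ₁ θ₂
    unfold plaqSU3
    ring
  simp_rw [hpt]
  rw [integral2_sub (by fun_prop) (by fun_prop), integral2_const_mul, integral2_const_mul,
    integral2_weylSU3_mul_pow, integral2_weylSU3_mul_pow]
  push_cast
  ring

/-- `su3Moment 0 = 6` (`= 3!`, the Weyl normalisation: `∫_{SU(3)} 1 = 1`). -/
theorem su3Moment_zero : su3Moment 0 = 6 := by
  decide +kernel

/-- `∫_0^{2π}∫_0^{2π} |Δ|² = 6 (2π)²`. -/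
theorem integral2_weylSU3 :
    (∫ θ₁ in (0 : ℝ)..2 * π, ∫ θ₂ in (0 : ℝ)..2 * π, weylSU3 θ₁ θ₂) = (2 * π) ^ 2 * 6 := by
  have h := integral2_weylSU3_mul_pow 0
  simp_rw [pow_zero, mul_one] at h
  rw [h, su3Moment_zero]
  push_cast
  ring

/-! ### 6. Haar sanity checks: the first three moments of `Re tr U` on `SU(3)` (appended 2026-08-21, GEN-6)

With `⟨·⟩ = (6(2π)²)⁻¹ ∫∫ · |Δ|²` the normalised expectation of class functions, the exact moments give
`⟨Re tr U⟩ = 0`, `⟨(Re tr U)²⟩ = ½`, `⟨(Re tr U)³⟩ = ¼` — in `SU(3)` language `∫ tr U dU = 0`,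
`∫ |tr U|² dU = 1` (the fundamental representation is irreducible) and `∫ (tr U)³ dU = 1` (the one cubic
invariant, `det`; an `SU(3)` signature — for `U(3)` the cubic moment of `Re tr U` vanishes).  They
identify the typed density `|Δ|²/(6(2π)²)` with the class-function image of Haar measure at the level of
its first three moments (a cross-check of `weylSU3`, `reTrSU3` and of the moment formula). -/

/-- `su3Moment 1 = 6` (`⟨1 + Re tr U⟩ = 1`). -/
theorem su3Moment_one : su3Moment 1 = 6 := by
  decide +kernel

/-- `su3Moment 2 = 9` (`⟨(1 + Re tr U)²⟩ = 3/2`). -/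
theorem su3Moment_two : su3Moment 2 = 9 := by
  decide +kernel

/-- `su3Moment 3 = 33/2` (`⟨(1 + Re tr U)³⟩ = 11/4`). -/
theorem su3Moment_three : su3Moment 3 = 33 / 2 := by
  decide +kernel

/-- **`∫_0^{2π}∫_0^{2π} |Δ|² Re tr U = 0`** (`⟨Re tr U⟩ = 0`: `∫_{SU(3)} tr U dU = 0`). -/
theorem integral2_weylSU3_mul_reTrSU3 :
    (∫ θ₁ in (0 : ℝ)..2 * π, ∫ θ₂ in (0 : ℝ)..2 * π, weylSU3 θ₁ θ₂ * reTrSU3 θ₁ θ₂) = 0 := by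
  have hpt : ∀ θ₁ θ₂ : ℝ, weylSU3 θ₁ θ₂ * reTrSU3 θ₁ θ₂
      = weylSU3 θ₁ θ₂ * (1 + reTrSU3 θ₁ θ₂) ^ 1 - weylSU3 θ₁ θ₂ * (1 + reTrSU3 θ₁ θ₂) ^ 0 := by
    intro θ₁ θ₂; ring
  simp_rw [hpt]
  rw [integral2_sub (by fun_prop) (by fun_prop), integral2_weylSU3_mul_pow, integral2_weylSU3_mul_pow,
    su3Moment_one, su3Moment_zero]
  push_cast
  ring

/-- **`∫_0^{2π}∫_0^{2π} |Δ|² (Re tr U)² = 3 (2π)²`** (`⟨(Re tr U)²⟩ = ½`: `∫_{SU(3)} |tr U|² dU = 1`). -/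
theorem integral2_weylSU3_mul_reTrSU3_sq :
    (∫ θ₁ in (0 : ℝ)..2 * π, ∫ θ₂ in (0 : ℝ)..2 * π, weylSU3 θ₁ θ₂ * reTrSU3 θ₁ θ₂ ^ 2)
      = 3 * (2 * π) ^ 2 := by
  have hpt : ∀ θ₁ θ₂ : ℝ, weylSU3 θ₁ θ₂ * reTrSU3 θ₁ θ₂ ^ 2
      = (weylSU3 θ₁ θ₂ * (1 + reTrSU3 θ₁ θ₂) ^ 2 - 2 * (weylSU3 θ₁ θ₂ * (1 + reTrSU3 θ₁ θ₂) ^ 1))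
        + weylSU3 θ₁ θ₂ * (1 + reTrSU3 θ₁ θ₂) ^ 0 := by
    intro θ₁ θ₂; ring
  simp_rw [hpt]
  rw [integral2_add (by fun_prop) (by fun_prop), integral2_sub (by fun_prop) (by fun_prop),
    integral2_const_mul, integral2_weylSU3_mul_pow, integral2_weylSU3_mul_pow, integral2_weylSU3_mul_pow,
    su3Moment_two, su3Moment_one, su3Moment_zero]
  push_cast
  ring

/-- **`∫_0^{2π}∫_0^{2π} |Δ|² (Re tr U)³ = (3/2) (2π)²`** (`⟨(Re tr U)³⟩ = ¼`: `∫_{SU(3)} (tr U)³ dU = 1`,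
the determinant invariant). -/
theorem integral2_weylSU3_mul_reTrSU3_cube :
    (∫ θ₁ in (0 : ℝ)..2 * π, ∫ θ₂ in (0 : ℝ)..2 * π, weylSU3 θ₁ θ₂ * reTrSU3 θ₁ θ₂ ^ 3)
      = 3 / 2 * (2 * π) ^ 2 := by
  have hpt : ∀ θ₁ θ₂ : ℝ, weylSU3 θ₁ θ₂ * reTrSU3 θ₁ θ₂ ^ 3
      = (weylSU3 θ₁ θ₂ * (1 + reTrSU3 θ₁ θ₂) ^ 3 - 3 * (weylSU3 θ₁ θ₂ * (1 + reTrSU3 θ₁ θ₂) ^ 2))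
        + (3 * (weylSU3 θ₁ θ₂ * (1 + reTrSU3 θ₁ θ₂) ^ 1) - weylSU3 θ₁ θ₂ * (1 + reTrSU3 θ₁ θ₂) ^ 0) := by
    intro θ₁ θ₂; ring
  simp_rw [hpt]
  rw [integral2_add (by fun_prop) (by fun_prop), integral2_sub (by fun_prop) (by fun_prop),
    integral2_sub (by fun_prop) (by fun_prop), integral2_const_mul, integral2_const_mul,
    integral2_weylSU3_mul_pow, integral2_weylSU3_mul_pow, integral2_weylSU3_mul_pow,
    integral2_weylSU3_mul_pow, su3Moment_three, su3Moment_two, su3Moment_one, su3Moment_zero]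
  push_cast
  ring

end Summit.Ventures.LatticeQCDFlow.Scoring
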